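import Summits.BirchSwinnertonDyer.BirchSwinnertonDyer.Theorems.AlignedTransportAtTwoMainConjectureOfRankZeroBSDAtTwoSelmerLayerKummerCount
import Summits.BirchSwinnertonDyer.BirchSwinnertonDyer.Theorems.AlignedTransportAtTwoMainConjectureOfRankZeroBSDAtTwoSelmerLayerTwistSemisimplicity
import Summits.BirchSwinnertonDyer.BirchSwinnertonDyer.Theorems.AlignedTransportAtTwoMainConjectureOfRankZeroBSDAtTwoSelmerLayerLambdaBudget
import HarnessLib

/-!
# Route `AlignedTransportAtTwo`, crux C2 `MainConjectureOfRankZeroBSDAtTwo` (stmt-BirchSwinnertonDyer-22298):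
# the lineage's layer theorems at `p = 2` — `ker g_n` finite at EVERY layer, first-layer matching, the `χ₈`-semisimplicity
# reading `j = e₀ ⟺ ker T² = ker T`, the Ш-inclusive growth dichotomy and the `λ`-budget — ALL UNCONDITIONAL

Cell `bsd-f1-sign2`, WIDTH-5 attach seat `bsd-line-att-p5` gen 42 (lineage att-p5; successor of g40's «layer control» and g41's
«Lemma 3.4 at the layers modulo the Kummer count»). **BSD is NOT proved; nothing closed; C2 NOT claimed; verdict «blocked-on
Rank1Residual.GreenbergMuConjectureIrreducible» untouched.** All theorems are `--supports 22298 --as helper`.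

With the layer Kummer count (C1ₙ) discharged (`Literature/…/SelmerCorankControlRatOrdinaryLayerKummerCountProofs`,
`…SelmerLayerKummerCount.finite_localTowerKerPrimary_two`: Greenberg's Lemma 3.4 at every layer of the cyclotomic `ℤ₂`-tower for
`E/ℚ` good ordinary at `2`), every statement of the gens 38–40 chain that carried «Finite ker g_n» / «Finite 𝒦_{v,n}[2^∞]» /
«`Greenberg1999.lemma34_…`» as a displayed hypothesis becomes a theorem at `p = 2`:

* ★★ `finite_kerG_two` — Greenberg's `ker g_n` (`Sel_{2^∞}(E_{ℚ_n}) → Sel_{2^∞}(E_{ℚ_∞})^{Γ_n}`) is finite at EVERY layer `n`.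
* ★★★★ `selmerCorank_layer_one_eq_add_two` — **`corank Sel_{2^∞}(E_{ℚ_1}/ℚ_1) = corank Sel_{2^∞}(E/ℚ) + rank_{ℤ₂} X/ξ₂X`**
  (`ℚ_1 = ℚ(√2)`, `ξ₂ = T + 2`; g40 `…SelmerLayerOneMatching` at `p = 2`).
* ★★★★ `forall_X_add_C_two_pow_dvd_iff_le_selmerCorank_iff` — **`j := ord_{T+2} f_X = e₀ := s_{2^∞}(W⁽²⁾) ⟺ ker T² = ker T` on
  `ℚ₂ ⊗ X(W⁽²⁾/ℚ_∞)`** (g38 NET (4)(iii) / g40 `…SelmerLayerTwistSemisimplicity`, now with NO local hypothesis).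
* ★★★★ `selmerCorank_layer_succ_le_or_cyclotomicLayer_dvd_two` — **the Ш-inclusive growth dichotomy at EVERY layer**: either
  `corank Sel_{2^∞}(E_{ℚ_{n+1}}) ≤ corank Sel_{2^∞}(E_{ℚ_n})` or `Ψ_{n+1} = Φ_{2^{n+1}}(1+T) ∣ f_X`.
* ★★★★ `sum_two_pow_selmerGrowthLayers_le_lambdaInvariant` / `selmerCorank_layer_succ_le_of_lambdaInvariant_lt_two` — **the
  `λ`-budget `∑_{growth layers n} 2ⁿ ≤ λ(X)`** and «no Selmer growth in `ℚ_{n+1}/ℚ_n` once `2ⁿ > λ(X)`», unconditional.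

Honest framing: COROLLARY-OF-PRINT (Greenberg LNM 1716 Thm 1.2 / Thm 1.9 / §3 Lemmas 3.1–3.5 / §5 p. 132, Mazur control) plus the
tree's two-sided matching; nothing beyond print; BSD proved for no curve; PARTITION: none moved.

References: R. Greenberg, LNM 1716 (1999), Thm 1.2, Thm 1.9 (p. 63), §3 Lemmas 3.1–3.5 (pp. 86–90), §5 p. 132 [GreenbergLNM1716];
T. & V. Dokchitser, Annals 172 (2010), Lemma 4.14 [DokchitserDokchitserAnnals2010].
-/

set_option linter.dupNamespace false
set_option autoImplicit false

noncomputable section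

open scoped Classical AddSubgroup TensorProduct Polynomial

universe u

namespace Summit.BirchSwinnertonDyer.BirchSwinnertonDyer.Theorems.AlignedTransportAtTwoSelmerLayerUnconditional

open Polynomial WeierstrassCurve Literature.NumberTheory.EllipticCurves Literature.NumberTheory.EllipticCurves.IwasawaAlgebra
  Literature.NumberTheory.EllipticCurves.IwasawaDual
  Summit.BirchSwinnertonDyer.Rank1Residual.X1.MuLambda
  Summit.BirchSwinnertonDyer.Rank1Residual.X1.CyclotomicZeros
  Summit.BirchSwinnertonDyer.BirchSwinnertonDyer.Theorems.AlignedTransportAtTwoSelmerLayerControl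
  Summit.BirchSwinnertonDyer.BirchSwinnertonDyer.Theorems.AlignedTransportAtTwoSelmerLayerControlLocal
  Summit.BirchSwinnertonDyer.BirchSwinnertonDyer.Theorems.AlignedTransportAtTwoSelmerLayerGrowthDichotomy
  Summit.BirchSwinnertonDyer.BirchSwinnertonDyer.Theorems.AlignedTransportAtTwoSelmerLayerOneMatching
  Summit.BirchSwinnertonDyer.BirchSwinnertonDyer.Theorems.AlignedTransportAtTwoSelmerLayerLambdaBudget
  Summit.BirchSwinnertonDyer.BirchSwinnertonDyer.Theorems.AlignedTransportAtTwoSelmerLayerTwistSemisimplicity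
  Summit.BirchSwinnertonDyer.BirchSwinnertonDyer.Theorems.AlignedTransportAtTwoSelmerLayerKummerCount

variable (W : WeierstrassCurve ℚ) [W.IsElliptic] [W.IsGloballyMinimal] {κ : ZpExtension ℚ 2}
  {γ : Field.absoluteGaloisGroup ℚ}

/-- ★★ **Greenberg's `ker g_n` is finite at EVERY layer `n` of the cyclotomic `ℤ₂`-tower, for `E/ℚ` good ordinary at `2`**
(`W/ℚ` globally minimal): Lemma 3.4 at the layer `n` is a theorem (`…SelmerLayerKummerCount.finite_localTowerKerPrimary_two`), and
Lemma 3.3 / good reduction handle the places `v ∤ 2` (`…SelmerLayerControlLocal.finite_kerG_of_finite_localTowerKerPrimary_dvd`).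
[cite: GreenbergLNM1716, §3 Lemmas 3.3–3.5 (pp. 86–90)] -/
theorem finite_kerG_two (h2 : IsOrdinaryAt W 2) (hκ : κ.IsCyclotomic) (n : ℕ) : Finite (W.KerG κ n) :=
  finite_kerG_of_finite_localTowerKerPrimary_dvd W κ n
    (fun v hv ↦ finite_localTowerKerPrimary_two W h2 hκ n v (by exact_mod_cast hv))

/-- ★★★★ **FIRST-LAYER MATCHING at `p = 2`, unconditional: `corank_{ℤ₂} Sel_{2^∞}(E_{ℚ_1}/ℚ_1) = corank_{ℤ₂} Sel_{2^∞}(E/ℚ) +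
rank_{ℤ₂} X/ξ₂X`** (`ℚ_1 = ℚ(√2)`, `ξ₂ = Φ₂(1+T) = T + 2`; `W/ℚ` globally minimal, good ordinary at `2`, `κ` cyclotomic with
topological generator `γ`, any dual datum): g40's `selmerCorank_layer_one_eq_add_of_finite_localTowerKerPrimary_one` with its
one local input now a theorem. [cite: GreenbergLNM1716, Thm 1.2 and §3 Lemma 3.4 (p. 89)] -/
theorem selmerCorank_layer_one_eq_add_two (h2 : IsOrdinaryAt W 2) (hκ : κ.IsCyclotomic) (hγ : κ.IsTopGenerator γ)
    (D : W.SelmerDualData κ γ) :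
    (W.baseChange (κ.layer 1)).selmerCorank 2 =
      W.selmerCorank 2 + lambdaInvariant 2 (D.X ⧸ (Ideal.span {xi 2} • ⊤ : Submodule (IwasawaAlgebra 2) D.X)) :=
  selmerCorank_layer_one_eq_add_of_finite_localTowerKerPrimary_one W h2.1 h2.2 hκ hγ D
    (fun v hv ↦ finite_localTowerKerPrimary_two W h2 hκ 1 v (by exact_mod_cast hv))

/-- ★★★★ **`j = e₀ ⟺ χ₈-SEMISIMPLICITY`, unconditional.** For `W/ℚ` globally minimal, good ordinary at `2`, `κ` cyclotomic with
topological generator `γ`, `D` a dual datum with `X` torsion and `char_Λ X = (f_X)`, `W₂` any `ℚ`-model of `W⁽²⁾` with a dual datum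
`D₂`: **`(∀ k, (T+2)^k ∣ f_X ↔ k ≤ corank_{ℤ₂} Sel_{2^∞}(W⁽²⁾/ℚ))`** — the `(T+2)`-multiplicity `j` of `f_X` EQUALS
`e₀ = s_{2^∞}(W⁽²⁾)` — **iff `ker T² = ker T` on `ℚ₂ ⊗ X(W₂/ℚ_∞)`** (g40
`…SelmerLayerTwistSemisimplicity.forall_X_add_C_two_pow_dvd_iff_le_selmerCorank_iff_of_finite_localTowerKerPrimary_two`, whose local
input is now a theorem). [cite: GreenbergLNM1716, §1 Conj. 1.12, §4 p. 107, Thm 1.2] [cite: DokchitserDokchitserAnnals2010, Lemma 4.14] -/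
theorem forall_X_add_C_two_pow_dvd_iff_le_selmerCorank_iff (hκ : κ.IsCyclotomic) (hγ : κ.IsTopGenerator γ)
    (W₂ : WeierstrassCurve ℚ) {V : VariableChange ℚ} (hV : V • W₂ = W.quadraticTwist 2) (h2 : IsOrdinaryAt W 2)
    (D : W.SelmerDualData κ γ) (hD : D.IsTorsion) {fX : IwasawaAlgebra 2} (hchar : D.charIdeal = Ideal.span {fX})
    (D₂ : W₂.SelmerDualData κ γ) :
    (∀ k : ℕ, (PowerSeries.X + PowerSeries.C (2 : ℤ_[2])) ^ k ∣ fX ↔ k ≤ (W.quadraticTwist 2).selmerCorank 2) ↔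
      LinearMap.ker (mulTRat 2 D₂.X ∘ₗ mulTRat 2 D₂.X) = LinearMap.ker (mulTRat 2 D₂.X) :=
  forall_X_add_C_two_pow_dvd_iff_le_selmerCorank_iff_of_finite_localTowerKerPrimary_two hκ hγ W W₂ hV h2 D hD hchar D₂
    (fun v hv ↦ finite_localTowerKerPrimary_two W h2 hκ 1 v hv)

/-- ★★★★ **THE Ш-INCLUSIVE GROWTH DICHOTOMY AT EVERY LAYER of the cyclotomic `ℤ₂`-tower, unconditional** (`W/ℚ` globally minimal,
good ordinary at `2`, `κ` cyclotomic with topological generator `γ`, `X` torsion with `char_Λ X = (f)`): for every `n`, **either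
`corank Sel_{2^∞}(E_{ℚ_{n+1}}/ℚ_{n+1}) ≤ corank Sel_{2^∞}(E_{ℚ_n}/ℚ_n)` or `Ψ_{n+1} = Φ_{2^{n+1}}(1+T) ∣ f`** (g40
`…SelmerLayerGrowthDichotomy` with `ker g_n` finite by `finite_kerG_two`). [cite: GreenbergLNM1716, Thm 1.2, §5 p. 132] -/
theorem selmerCorank_layer_succ_le_or_cyclotomicLayer_dvd_two (h2 : IsOrdinaryAt W 2) (hκ : κ.IsCyclotomic)
    (hγ : κ.IsTopGenerator γ) (D : W.SelmerDualData κ γ) (hD : D.IsTorsion) (n : ℕ) {f : IwasawaAlgebra 2}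
    (hf : D.charIdeal = Ideal.span {f}) :
    (W.baseChange (κ.layer (n + 1))).selmerCorank 2 ≤ (W.baseChange (κ.layer n)).selmerCorank 2 ∨
      (((cyclotomic (2 ^ (n + 1)) ℤ_[2]).comp (Polynomial.X + 1) : ℤ_[2][X]) : PowerSeries ℤ_[2]) ∣ f := by
  haveI : Module.Finite (IwasawaAlgebra 2) D.X := SelmerDualData.module_finite_of_isCyclotomic W κ hκ D hγ
  haveI := finite_kerG_two W h2 hκ n
  exact selmerCorank_layer_succ_le_or_cyclotomicLayer_dvd_of_finite_kerG W κ hγ D hD n hf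

/-- ★★★★ **THE `λ`-BUDGET OF SELMER GROWTH along the cyclotomic `ℤ₂`-tower, unconditional: `∑_{n ∈ S} 2ⁿ ≤ λ(X)`** for every
finite set `S` of layers at which the `2^∞`-Selmer corank GROWS from `ℚ_n` to `ℚ_{n+1}` (more points or more `Ш[2^∞]`-corank;
`W/ℚ` globally minimal, good ordinary at `2`, `κ` cyclotomic with topological generator `γ`, `X` torsion with `char_Λ X = (f_E)`).
g40 `…SelmerLayerLambdaBudget` with `ker g_n` finite at every layer (`finite_kerG_two`). [cite: GreenbergLNM1716, Thm. 1.9 (p. 63) and §5 p. 132] -/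
theorem sum_two_pow_selmerGrowthLayers_le_lambdaInvariant (h2 : IsOrdinaryAt W 2) (hκ : κ.IsCyclotomic)
    (hγ : κ.IsTopGenerator γ) (D : W.SelmerDualData κ γ) (hD : D.IsTorsion) {fE : IwasawaAlgebra 2}
    (hfE : D.charIdeal = Ideal.span {fE}) (S : Finset ℕ)
    (hS : ∀ n ∈ S, (W.baseChange (κ.layer n)).selmerCorank 2 < (W.baseChange (κ.layer (n + 1))).selmerCorank 2) :
    ∑ n ∈ S, 2 ^ n ≤ lambdaInvariant 2 D.X := by
  haveI : Module.Finite (IwasawaAlgebra 2) D.X := SelmerDualData.module_finite_of_isCyclotomic W κ hκ D hγ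
  have h := sum_totient_selmerGrowthLayers_le_lambdaInvariant_of_finite_kerG W κ hγ D hD hfE S
    (fun n _ ↦ finite_kerG_two W h2 hκ n) hS
  simpa using h

/-- ★★★★ **NO SELMER GROWTH BEYOND THE `λ`-BUDGET, unconditional**: if `2ⁿ > λ(f_E)` then
`corank Sel_{2^∞}(E_{ℚ_{n+1}}/ℚ_{n+1}) ≤ corank Sel_{2^∞}(E_{ℚ_n}/ℚ_n)` — no new independent points AND no new `Ш[2^∞]`-corank in
`ℚ_{n+1}/ℚ_n` (g40 `selmerCorank_layer_succ_le_of_lam_lt_of_finite_kerG` with `finite_kerG_two`).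
[cite: GreenbergLNM1716, Thm. 1.9 (p. 63) and §5 p. 132] -/
theorem selmerCorank_layer_succ_le_of_lam_lt_two (h2 : IsOrdinaryAt W 2) (hκ : κ.IsCyclotomic)
    (hγ : κ.IsTopGenerator γ) (D : W.SelmerDualData κ γ) (hD : D.IsTorsion) {fE : IwasawaAlgebra 2}
    (hfE : D.charIdeal = Ideal.span {fE}) (n : ℕ) (hlam : lam fE < 2 ^ n) :
    (W.baseChange (κ.layer (n + 1))).selmerCorank 2 ≤ (W.baseChange (κ.layer n)).selmerCorank 2 := by
  haveI : Module.Finite (IwasawaAlgebra 2) D.X := SelmerDualData.module_finite_of_isCyclotomic W κ hκ D hγ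
  haveI := finite_kerG_two W h2 hκ n
  exact selmerCorank_layer_succ_le_of_lam_lt_of_finite_kerG W κ hγ D hD hfE n (by simpa using hlam)

end Summit.BirchSwinnertonDyer.BirchSwinnertonDyer.Theorems.AlignedTransportAtTwoSelmerLayerUnconditional

end
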